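import Summits.Ventures.PercRepro.S1CoreCapSpecSpreadSixLinesB
import Summits.Ventures.PercRepro.S1CoreCapSpecSpreadSixLinesA

/-!
# PercRepro — TOWARDS THE INSTANCE `ν = 6` OF THE SPREAD SPEC: ALL-SIMPLE CONFIGURATIONS OF COST `≤ 6` HAVE AT MOST NINE LINES (p1, gen 32)

`proofs/P1-S2-CORANK6.md` §4h. `tf_W_le_three_six`: four lines meeting the triangle-free base once are impossible at nullity `6` — three
of them pairwise meeting is refused (`no_fourth_W_of_triangle`), otherwise a disjoint pair among three of them makes the fourth meet two of
them (`W_meets_two`), and the case analysis ends in a triangle or in a 4-cycle with disjoint diagonals (`no_C4_W`). Then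
**`card_le_nine_of_three_points_spread_six`**: a triangle ⟹ `4 + 4`; triangle-free with a line off the pencil centre ⟹ `3 + 3 + 3` (the lines
disjoint from the base are `≤ 4` and four of cost `≤ 3` would contain a triangle, `triangle_of_four_cost_three`); the pencil ⟹ `2 + 5`,
`3 + 4`, `6 + 2`; pairwise disjoint ⟹ `6`. The search's maximum is `8` (two disjoint `K₄`); `9` is what the cap `9` needs. Axioms: standard.
-/

namespace PercRepro

namespace S1

namespace FourCap

variable {β : Type} [DecidableEq β]

section SixLinesC

variable {w : β → ℕ} {ls : Finset (Finset β)}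
  (hw1 : ∀ L ∈ ls, ∀ v ∈ L, w v = 1)
  (hcard : ∀ L ∈ ls, L.card = 3)
  (h3 : ∀ L ∈ ls, ∀ L' ∈ ls, L ≠ L' → (L ∩ L').card ≤ 1)
  (h7 : ∀ l : List (Finset β), l.Nodup → (∀ L ∈ l, L ∈ ls) → lineRank l ≤ 4 → wsum w (unionL l) ≤ lineRank l + 3)

include hw1 hcard h3 h7 in
/-- **At most three lines meet the triangle-free base once at nullity `6`.** -/
theorem tf_W_le_three_six
    (h4 : ∀ l : List (Finset β), l.Nodup → (∀ L ∈ l, L ∈ ls) → wsum w (unionL l) ≤ 6 + lineRank l)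
    (htf : ∀ X ∈ ls, ∀ Y ∈ ls, ∀ Z ∈ ls, X ≠ Y → Y ≠ Z → X ≠ Z → (X ∩ Y).Nonempty → (Y ∩ Z).Nonempty →
      (X ∩ Z).Nonempty → (X ∩ Y ∩ Z).Nonempty)
    {A X Y : Finset β} (hA : A ∈ ls) (hX : X ∈ ls) (hY : Y ∈ ls) (hAX : A ≠ X) (hYA : Y ≠ A) (hYX' : Y ≠ X)
    (hrank : lineRank [Y, X, A] = 4) (hcardU : (unionL [Y, X, A]).card = 7) :
    (ls.filter (fun L => L ≠ A ∧ L ≠ X ∧ L ≠ Y ∧ (L ∩ unionL [Y, X, A]).card = 1)).card ≤ 3 := by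
  set 𝓦 := ls.filter (fun L => L ≠ A ∧ L ≠ X ∧ L ≠ Y ∧ (L ∩ unionL [Y, X, A]).card = 1) with h𝓦
  by_contra hlt
  push Not at hlt
  obtain ⟨Z₁, Z₂, Z₃, hZ₁, hZ₂, hZ₃, h12, h13, h23⟩ := Finset.two_lt_card_iff.1 (by omega : 2 < 𝓦.card)
  have hZ₂' : Z₂ ∈ 𝓦.erase Z₁ := Finset.mem_erase.2 ⟨h12.symm, hZ₂⟩
  have hZ₃' : Z₃ ∈ (𝓦.erase Z₁).erase Z₂ := Finset.mem_erase.2 ⟨h23.symm, Finset.mem_erase.2 ⟨h13.symm, hZ₃⟩⟩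
  have hpos : 0 < (((𝓦.erase Z₁).erase Z₂).erase Z₃).card := by
    rw [Finset.card_erase_of_mem hZ₃', Finset.card_erase_of_mem hZ₂', Finset.card_erase_of_mem hZ₁]
    omega
  obtain ⟨Z₄, hZ₄''⟩ := Finset.card_pos.1 hpos
  simp only [Finset.mem_erase] at hZ₄''
  obtain ⟨h43, h42, h41, hZ₄⟩ := hZ₄''
  have mem : ∀ {Z : Finset β}, Z ∈ 𝓦 → Z ∈ ls ∧ Z ≠ A ∧ Z ≠ X ∧ Z ≠ Y ∧ (Z ∩ unionL [Y, X, A]).card = 1 :=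
    fun h => Finset.mem_filter.1 h
  have sym : ∀ {S T : Finset β}, (S ∩ T).Nonempty → (T ∩ S).Nonempty := fun h => by rw [Finset.inter_comm]; exact h
  -- three pairwise meeting lines of `𝓦` and a fourth: refused
  have T : ∀ {P Q R S : Finset β}, P ∈ 𝓦 → Q ∈ 𝓦 → R ∈ 𝓦 → S ∈ 𝓦 → Q ≠ P → R ≠ P → R ≠ Q → S ≠ P → S ≠ Q → S ≠ R →
      (P ∩ Q).Nonempty → (Q ∩ R).Nonempty → (P ∩ R).Nonempty → False := by
    intro P Q R S hP hQ hR hS hQP hRP hRQ hSP hSQ hSR mPQ mQR mPR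
    obtain ⟨hP, hPA, hPX, hPY, kP⟩ := mem hP
    obtain ⟨hQ, hQA, hQX, hQY, kQ⟩ := mem hQ
    obtain ⟨hR, hRA, hRX, hRY, kR⟩ := mem hR
    obtain ⟨hS, hSA, hSX, hSY, kS⟩ := mem hS
    exact no_fourth_W_of_triangle hw1 hcard h3 h4 htf hA hX hY hAX hYA hYX' hrank hcardU hP hQ hR hS hPA hPX hPY hQA hQX hQY
      hRA hRX hRY hSA hSX hSY hQP hRP hRQ hSP hSQ hSR kP kQ kR kS mPQ mQR mPR
  -- a line of `𝓦` meets two of three others of which two are disjoint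
  have M2 : ∀ {P Q R S : Finset β}, P ∈ 𝓦 → Q ∈ 𝓦 → R ∈ 𝓦 → S ∈ 𝓦 → Q ≠ P → R ≠ P → R ≠ Q → S ≠ P → S ≠ Q → S ≠ R →
      Disjoint Q R → ((S ∩ R).Nonempty ∧ (S ∩ Q).Nonempty) ∨ ((S ∩ R).Nonempty ∧ (S ∩ P).Nonempty) ∨
        ((S ∩ Q).Nonempty ∧ (S ∩ P).Nonempty) := by
    intro P Q R S hP hQ hR hS hQP hRP hRQ hSP hSQ hSR hQR
    obtain ⟨hP, hPA, hPX, hPY, kP⟩ := mem hP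
    obtain ⟨hQ, hQA, hQX, hQY, kQ⟩ := mem hQ
    obtain ⟨hR, hRA, hRX, hRY, kR⟩ := mem hR
    obtain ⟨hS, hSA, hSX, hSY, kS⟩ := mem hS
    exact W_meets_two hw1 hcard h3 h4 hA hX hY hAX hYA hYX' hrank hcardU hP hQ hR hS hPA hPX hPY hQA hQX hQY hRA hRX hRY hSA
      hSX hSY hQP hRP hRQ hSP hSQ hSR kP kQ kR kS hQR
  -- the 4-cycle
  have C4 : ∀ {P Q R S : Finset β}, P ∈ 𝓦 → Q ∈ 𝓦 → R ∈ 𝓦 → S ∈ 𝓦 → Q ≠ P → R ≠ P → R ≠ Q → S ≠ P → S ≠ Q → S ≠ R →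
      Disjoint P R → Disjoint Q S → (P ∩ Q).Nonempty → (Q ∩ R).Nonempty → (R ∩ S).Nonempty → (S ∩ P).Nonempty → False := by
    intro P Q R S hP hQ hR hS hQP hRP hRQ hSP hSQ hSR dPR dQS mPQ mQR mRS mSP
    exact no_C4_W hw1 hcard h3 h7 (mem hP).1 (mem hQ).1 (mem hR).1 (mem hS).1 hQP hRP hRQ hSP hSQ hSR dPR dQS mPQ mQR mRS mSP
  have ndis : ∀ {S T : Finset β}, ¬ Disjoint S T → (S ∩ T).Nonempty := fun h => by
    rw [Finset.not_disjoint_iff] at h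
    obtain ⟨x, hx, hx'⟩ := h
    exact ⟨x, Finset.mem_inter.2 ⟨hx, hx'⟩⟩
  -- THE CORE: a disjoint pair `Zx, Zy`, the third `Zz` and the fourth `Z4`
  have core : ∀ {Zx Zy Zz Z4 : Finset β}, Zx ∈ 𝓦 → Zy ∈ 𝓦 → Zz ∈ 𝓦 → Z4 ∈ 𝓦 → Zy ≠ Zx → Zz ≠ Zx → Zz ≠ Zy → Z4 ≠ Zx →
      Z4 ≠ Zy → Z4 ≠ Zz → Disjoint Zx Zy → False := by
    intro Zx Zy Zz Z4 hx hy hz h4' hyx hzx hzy h4x h4y h4z dxy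
    have exy : Zx ∩ Zy = ∅ := Finset.disjoint_iff_inter_eq_empty.1 dxy
    have eyx : Zy ∩ Zx = ∅ := Finset.disjoint_iff_inter_eq_empty.1 dxy.symm
    rcases M2 hz hx hy h4' hzx.symm hzy.symm hyx h4z h4x h4y dxy with ⟨m4y, m4x⟩ | ⟨m4y, m4z⟩ | ⟨m4x, m4z⟩
    · -- `Z4` meets `Zx` and `Zy`: `Zz` meets two of `Zx, Zy, Z4`
      rcases M2 h4' hx hy hz h4x.symm h4y.symm hyx h4z.symm hzx hzy dxy with ⟨mzy, mzx⟩ | ⟨mzy, mz4⟩ | ⟨mzx, mz4⟩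
      · -- the 4-cycle `Zx – Zz – Zy – Z4 – Zx`
        have dz4 : Disjoint Zz Z4 := by
          by_contra hnd
          exact T hz h4' hx hy h4z hzx.symm h4x.symm hzy.symm h4y.symm hyx (ndis hnd) m4x mzx
        exact C4 hx hz hy h4' hzx hyx hzy.symm h4x h4z h4y dxy dz4 (sym mzx) mzy (sym m4y) m4x
      · exact T hz hy h4' hx hzy.symm h4z h4y hzx.symm hyx.symm h4x.symm mzy (sym m4y) mz4
      · exact T hz hx h4' hy hzx.symm h4z h4x hzy.symm hyx h4y.symm mzx (sym m4x) mz4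
    · -- `Z4` meets `Zy` and `Zz`: then `Zy ∩ Zz = ∅`, and `Zx` meets two of `Zy, Zz, Z4` — not `Zy`
      have dyz : Disjoint Zy Zz := by
        by_contra hnd
        exact T h4' hy hz hx h4y.symm h4z.symm hzy h4x.symm hyx.symm hzx.symm m4y (ndis hnd) m4z
      rcases M2 h4' hy hz hx h4y.symm h4z.symm hzy h4x.symm hyx.symm hzx.symm dyz with ⟨_, mxy⟩ | ⟨mxz, mx4⟩ | ⟨mxy, _⟩
      · exact absurd mxy (by rw [Finset.not_nonempty_iff_eq_empty]; exact exy)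
      · exact T hx hz h4' hy hzx h4x h4z hyx hzy.symm h4y.symm mxz (sym m4z) mx4
      · exact absurd mxy (by rw [Finset.not_nonempty_iff_eq_empty]; exact exy)
    · -- `Z4` meets `Zx` and `Zz`: then `Zx ∩ Zz = ∅`, and `Zy` meets two of `Zx, Zz, Z4` — not `Zx`
      have dxz : Disjoint Zx Zz := by
        by_contra hnd
        exact T h4' hx hz hy h4x.symm h4z.symm hzx h4y.symm hyx hzy.symm m4x (ndis hnd) m4z
      rcases M2 h4' hx hz hy h4x.symm h4z.symm hzx h4y.symm hyx hzy.symm dxz with ⟨_, myx⟩ | ⟨myz, my4⟩ | ⟨myx, _⟩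
      · exact absurd myx (by rw [Finset.not_nonempty_iff_eq_empty]; exact eyx)
      · exact T hy hz h4' hx hzy h4y h4z hyx.symm hzx.symm h4x.symm myz (sym m4z) my4
      · exact absurd myx (by rw [Finset.not_nonempty_iff_eq_empty]; exact eyx)
  -- a disjoint pair among `Z₁, Z₂, Z₃`
  by_cases m12 : (Z₁ ∩ Z₂).Nonempty
  · by_cases m23 : (Z₂ ∩ Z₃).Nonempty
    · have d13 : Disjoint Z₁ Z₃ := by
        by_contra hnd
        exact T hZ₁ hZ₂ hZ₃ hZ₄ h12.symm h13.symm h23.symm h41 h42 h43 m12 m23 (ndis hnd)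
      exact core hZ₁ hZ₃ hZ₂ hZ₄ h13.symm h12.symm h23 h41 h43 h42 d13
    · have d23 : Disjoint Z₂ Z₃ := by
        by_contra hnd
        exact m23 (ndis hnd)
      exact core hZ₂ hZ₃ hZ₁ hZ₄ h23.symm h12 h13 h42 h43 h41 d23
  · have d12 : Disjoint Z₁ Z₂ := by
      by_contra hnd
      exact m12 (ndis hnd)
    exact core hZ₁ hZ₂ hZ₃ hZ₄ h12.symm h13.symm h23.symm h41 h42 h43 d12

include hw1 hcard h3 h7 in
/-- **Every all-simple configuration of cost `≤ 6` under the spread clause has at most nine lines** (the search: eight, two disjoint `K₄`). -/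
theorem card_le_nine_of_three_points_spread_six
    (h4 : ∀ l : List (Finset β), l.Nodup → (∀ L ∈ l, L ∈ ls) → wsum w (unionL l) ≤ 6 + lineRank l) : ls.card ≤ 9 := by
  have h1' := h1_of_simple hw1
  have h2' := h2_of_simple hw1 hcard
  -- the lines disjoint from a base of cost `c` form an all-simple configuration of cost `6 − c`
  have hDsimple : ∀ {b : List (Finset β)}, b.Nodup → (∀ L ∈ b, L ∈ ls) → ∀ {ν' : ℕ}, 6 + lineRank b ≤ ν' + wsum w (unionL b) →
      ∀ l : List (Finset β), l.Nodup → (∀ L ∈ l, L ∈ ls.filter (fun L => Disjoint L (unionL b))) →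
        wsum w (unionL l) ≤ ν' + lineRank l := by
    intro b hb hbl ν' hcost l hl hll
    have hD : ∀ L ∈ ls.filter (fun L => Disjoint L (unionL b)), L ∈ ls ∧ Disjoint L (unionL b) :=
      fun L hL => Finset.mem_filter.1 hL
    refine cost_clause_restrict_gen h4 hb hbl hcost l hl (fun L hL => (hD L (hll L hL)).1)
      (fun L hL => (hD L (hll L hL)).2) ?_
    intro L hL hLb
    exact not_disjoint_unionL_of_mem h2' hbl hLb (hD L (hll L hL)).2
  by_cases htri : ∃ X ∈ ls, ∃ Y ∈ ls, ∃ Z ∈ ls, X ≠ Y ∧ Y ≠ Z ∧ X ≠ Z ∧ (X ∩ Y).Nonempty ∧ (Y ∩ Z).Nonempty ∧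
      (X ∩ Z).Nonempty ∧ X ∩ Y ∩ Z = ∅
  · obtain ⟨X, hX, Y, hY, Z, hZ, hXY, hYZ, hXZ, ⟨c, hc⟩, ⟨a, ha⟩, ⟨b, hb⟩, hempty⟩ := htri
    rw [Finset.mem_inter] at hc ha hb
    have hab : a ≠ b := by
      rintro rfl
      exact Finset.notMem_empty a (hempty ▸ Finset.mem_inter.2 ⟨Finset.mem_inter.2 ⟨hb.1, ha.1⟩, ha.2⟩)
    have hac : a ≠ c := by
      rintro rfl
      exact Finset.notMem_empty a (hempty ▸ Finset.mem_inter.2 ⟨Finset.mem_inter.2 ⟨hc.1, hc.2⟩, ha.2⟩)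
    have hbc : b ≠ c := by
      rintro rfl
      exact Finset.notMem_empty b (hempty ▸ Finset.mem_inter.2 ⟨Finset.mem_inter.2 ⟨hb.1, hc.2⟩, hb.2⟩)
    obtain ⟨hrank, hcardU⟩ := triangle_base hcard h3 hX hY hZ hXY.symm hXZ.symm hYZ.symm hc.1 hc.2 ha.1 ha.2 hb.1 hb.2 hab
    have hb' : ([Z, Y, X] : List (Finset β)).Nodup := by simp [hXY.symm, hXZ.symm, hYZ.symm]
    have hbl : ∀ L ∈ ([Z, Y, X] : List (Finset β)), L ∈ ls := by simp [hX, hY, hZ]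
    have hwU : wsum w (unionL [Z, Y, X]) = 6 := by rw [wsum_unionL_eq_card hw1 _ hbl, hcardU]
    have hD := card_filter_disjoint_le_four_gen h1' h2' h3 h4 hb' hbl (by rw [hrank, hwU])
    have := card_le_of_triangle_gen hw1 hcard h3 h7 hX hY hZ hXY.symm hXZ.symm hYZ.symm hc.1 hc.2 ha.1 ha.2 hb.1 hb.2
      hab hac hbc hD
    omega
  · push Not at htri
    by_cases hmeet : ∃ A ∈ ls, ∃ X ∈ ls, A ≠ X ∧ (A ∩ X).Nonempty
    · obtain ⟨A, hA, X, hX, hAX, ⟨a, ha⟩⟩ := hmeet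
      rw [Finset.mem_inter] at ha
      by_cases hY : ∃ B ∈ ls, a ∈ B ∧ ∃ Y ∈ ls, a ∉ Y ∧ (Y ∩ B).Nonempty
      · obtain ⟨B, hB, haB, Y, hYl, haY, hYB⟩ := hY
        have hYB' : Y ≠ B := fun h => haY (h ▸ haB)
        have key : ∀ {B' : Finset β}, B' ∈ ls → B ≠ B' → a ∈ B' → ls.card ≤ 9 := by
          intro B' hB' hBB' haB'
          have hYB'' : Y ≠ B' := fun h => haY (h ▸ haB')
          have hYB'd : Disjoint Y B' := tf_disjoint_of_meet h3 htri hB hB' hYl hBB' hYB' hYB'' haB haB' haY hYB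
          obtain ⟨hrank, hcardU⟩ := tf_base hcard h3 hB hB' hYl hBB' hYB' haB haB' hYB hYB'd
          have hb' : ([Y, B', B] : List (Finset β)).Nodup := by simp [hBB'.symm, hYB', hYB'']
          have hbl : ∀ L ∈ ([Y, B', B] : List (Finset β)), L ∈ ls := by simp [hB, hB', hYl]
          have hwU : wsum w (unionL [Y, B', B]) = 7 := by rw [wsum_unionL_eq_card hw1 _ hbl, hcardU]
          -- the lines disjoint from the base: at most four, and four would contain a triangle
          set 𝓓 := ls.filter (fun L => Disjoint L (unionL [Y, B', B])) with h𝓓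
          have hDm : ∀ L ∈ 𝓓, L ∈ ls := fun L hL => (Finset.mem_filter.1 hL).1
          have hD4 : 𝓓.card ≤ 4 := card_filter_disjoint_le_four_gen h1' h2' h3 h4 hb' hbl (by rw [hrank, hwU])
          have hD3 : 𝓓.card ≤ 3 := by
            by_contra hlt
            push Not at hlt
            obtain ⟨D₁, D₂, D₃, hD₁, hD₂, hD₃, d12, d13, d23⟩ := Finset.two_lt_card_iff.1 (by omega : 2 < 𝓓.card)
            have hD₂' : D₂ ∈ 𝓓.erase D₁ := Finset.mem_erase.2 ⟨d12.symm, hD₂⟩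
            have hD₃' : D₃ ∈ (𝓓.erase D₁).erase D₂ := Finset.mem_erase.2 ⟨d23.symm, Finset.mem_erase.2 ⟨d13.symm, hD₃⟩⟩
            have hpos : 0 < (((𝓓.erase D₁).erase D₂).erase D₃).card := by
              rw [Finset.card_erase_of_mem hD₃', Finset.card_erase_of_mem hD₂', Finset.card_erase_of_mem hD₁]
              omega
            obtain ⟨D₄, hD₄''⟩ := Finset.card_pos.1 hpos
            simp only [Finset.mem_erase] at hD₄''
            obtain ⟨d43, d42, d41, hD₄⟩ := hD₄''
            have h4D : ∀ l : List (Finset β), l.Nodup → (∀ L ∈ l, L ∈ 𝓓) → wsum w (unionL l) ≤ 3 + lineRank l :=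
              hDsimple hb' hbl (by rw [hrank, hwU])
            obtain ⟨P, hP, Q, hQ, R, hR, hPQ, hQR, hPR, mPQ, mQR, mPR, hPQR⟩ :=
              triangle_of_four_cost_three (fun L hL => hw1 L (hDm L hL)) (fun L hL => hcard L (hDm L hL))
                (fun L hL L' hL' hne => h3 L (hDm L hL) L' (hDm L' hL') hne) h4D hD₁ hD₂ hD₃ hD₄ d12.symm d13.symm
                d23.symm d41 d42 d43
            exact absurd (htri P (hDm P hP) Q (hDm Q hQ) R (hDm R hR) hPQ hQR hPR mPQ mQR mPR)
              (by rw [Finset.not_nonempty_iff_eq_empty]; exact hPQR)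
          have hW := tf_W_le_three_six hw1 hcard h3 h7 h4 htri hB hB' hYl hBB' hYB' hYB'' hrank hcardU
          have := tf_count_gen hw1 hcard h3 h7 htri hB hB' hYl hBB' hYB' hYB'' haB haB' haY hYB hW hD3
          omega
        by_cases hBA : B = A
        · subst hBA
          exact key hX hAX ha.2
        · exact key hA hBA ha.1
      · push Not at hY
        have hno : ∀ Y ∈ ls, a ∉ Y → ∀ B ∈ ls, a ∈ B → Disjoint Y B := fun Y hYl haY B hB haB => by
          rw [Finset.disjoint_iff_inter_eq_empty]
          exact hY B hB haB Y hYl haY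
        rcases pencil_count_gen hw1 hcard h3 h4 (d₂ := 5) (d₃ := 4) (d₄ := 2) hA hX hAX ha.1 ha.2 hno
          (fun {b} hb hbl hr hu => by
            -- two pencil lines: the lines avoiding the centre cost `≤ 4`
            have hD : ∀ L ∈ ls.filter (fun L => Disjoint L (unionL b)), L ∈ ls := fun L hL => (Finset.mem_filter.1 hL).1
            exact card_le_five_of_three_points_spread_four (fun L hL => hw1 L (hD L hL)) (fun L hL => hcard L (hD L hL))
              (fun L hL L' hL' hne => h3 L (hD L hL) L' (hD L' hL') hne) (fun l hl hll => h7 l hl (fun L hL => hD L (hll L hL)))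
              (hDsimple hb hbl (by rw [hr, hu])))
          (fun {b} hb hbl hr hu => card_filter_disjoint_le_four_gen h1' h2' h3 h4 hb hbl (by rw [hr, hu]))
          (fun {b} hb hbl hr hu => card_filter_disjoint_le_two_gen h1' h2' h3 h4 hb hbl (by rw [hr, hu])) with h | h | h
        · omega
        · omega
        · omega
    · push Not at hmeet
      exact card_le_nu_of_pairwise_disjoint hw1 hcard (ν := 6) h4 (fun L hL L' hL' hne => by
        rw [Finset.disjoint_iff_inter_eq_empty]; exact hmeet L hL L' hL' hne) |>.trans (by norm_num)

end SixLinesC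

end FourCap

end S1

end PercRepro
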